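import Summits.ValiantsHypothesis.ValiantsHypothesis.Theorems.NewtonUnitEquationsTwoProductsSubmergedHighLetterExpansion
import Summits.ValiantsHypothesis.ValiantsHypothesis.Theorems.NewtonUnitEquationsTwoProductsSubmergedDefs

/-!
# K4 `submerged-band-filtration` — L4: NEWTON–VIETA PAIRING OF THE HIGH LETTERS (`highLetterPairing_holds : HighLetterPairing`)

val-idea-36 g0's L4 («the lever»; text appended verbatim to `…SubmergedDefs`).  One alphabet `E`, high letters `H ⊆ E` with PURE fibres,
all non-zero `H`-tuple points strictly above the visible point `l` ⇒ the rows `(u_j|_H)_j` and `(v_j|_H)_j` coincide up to a permutation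
of the positions.  Proof (Newton–Vieta, no genericity argument):
1. every non-zero `H`-tuple point `p` is cancelled in `∏(1+u) − ∏(1+v)` (strict top); by purity its fibre in `∏_j (E ∪ {0})` consists of
   `H`-tuples only, so the FIBRE SUMS of the restricted families `u^H := keepSet u H₀`, `v^H` (`H₀ = H ∖ {0}`) agree at every point
   (`fibreSum_keepSet_eq`);
2. by purity all tuples of one fibre are rearrangements of each other, hence have the same number of non-zero slots, so the GRADED fibre
   sums agree too, i.e. (graded expansion `coeff_esymm_eq_fibreSum`) the elementary symmetric polynomials OF THE TAILS agree:
   `e_r(u^H) = e_r(v^H)` in `ℂ[X,Y]` for every `r` (`esymmTail_keepSet_eq`);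
3. Vieta (`Finset.prod_X_add_C_coeff`): `∏_j (Z + u^H_j) = ∏_j (Z + v^H_j)` in `ℂ[X,Y][Z]`; `ℂ[X,Y]` is a domain, so the root multisets
   agree (`Polynomial.roots_multiset_prod_X_sub_C`): `{u^H_j} = {v^H_j}` as multisets;
4. equal multisets of a `Fin m`-indexed family differ by a permutation of `Fin m` (`exists_perm_of_map_eq`), which is the conclusion.
Helper mode (`--supports stmt-ValiantsHypothesis-5906 --as helper`).  Honest framing: infrastructure lemma of the K4 card (permutation type
on the high band DERIVED from cancellation); nothing here closes 5906 (`TwoProducts` / `ResidualLawV23` / `PlanarCellBound` OPEN); VP ≠ VNP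
is NOT proved.  No instances, no notation, no named facts. [folklore]
-/

noncomputable section
set_option linter.dupNamespace false

namespace Summit.ValiantsHypothesis.ValiantsHypothesis.Theorems.NewtonUnitEquations.TwoProducts.Submerged
open scoped BigOperators
open MvPolynomial
open Summit.ValiantsHypothesis.ValiantsHypothesis.Theorems.NewtonUnitEquations.TwoProducts.FormalLogLinearisation
open Summit.ValiantsHypothesis.ValiantsHypothesis.Theorems.NewtonUnitEquations.TwoProducts.PlanarCell

variable {m : ℕ}

/-! ## Multisets of a finite family and permutations -/

/-- Two `Fin m`-indexed families with the same multiset of values differ by a permutation of the index set. [folklore] -/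
theorem exists_perm_of_map_eq {α : Type*} [DecidableEq α] (f g : Fin m → α)
    (h : (Finset.univ : Finset (Fin m)).val.map f = (Finset.univ : Finset (Fin m)).val.map g) :
    ∃ σ : Equiv.Perm (Fin m), ∀ j, g (σ j) = f j := by
  classical
  -- fibres have equal cardinalities
  have hcard : ∀ a : α, Fintype.card {j // f j = a} = Fintype.card {j // g j = a} := by
    intro a
    have h1 := congrArg (Multiset.count a) h
    rw [Multiset.count_map, Multiset.count_map] at h1
    rw [Fintype.card_subtype, Fintype.card_subtype]
    have e1 : (Finset.univ.filter fun j => f j = a).card =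
        Multiset.card (Multiset.filter (fun j => a = f j) (Finset.univ : Finset (Fin m)).val) := by
      rw [← Finset.filter_val, Finset.card_val]
      congr 1
      ext j
      simp only [Finset.mem_filter, Finset.mem_univ, true_and]
      exact eq_comm
    have e2 : (Finset.univ.filter fun j => g j = a).card =
        Multiset.card (Multiset.filter (fun j => a = g j) (Finset.univ : Finset (Fin m)).val) := by
      rw [← Finset.filter_val, Finset.card_val]
      congr 1
      ext j
      simp only [Finset.mem_filter, Finset.mem_univ, true_and]
      exact eq_comm
    rw [e1, e2, h1]
  -- fibrewise bijections, glued along the fibrations of `f` and `g`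
  let e : ∀ a : α, {j // f j = a} ≃ {j // g j = a} := fun a => Fintype.equivOfCardEq (hcard a)
  let σ : Equiv.Perm (Fin m) :=
    ((Equiv.sigmaFiberEquiv f).symm.trans (Equiv.sigmaCongrRight e)).trans (Equiv.sigmaFiberEquiv g)
  refine ⟨σ, fun j => ?_⟩
  have : σ j = ((e (f j)) ⟨j, rfl⟩).1 := rfl
  rw [this]
  exact ((e (f j)) ⟨j, rfl⟩).2

/-- Equal products of linear factors over the domain `ℂ[X,Y]` have equal root multisets. [folklore] -/
theorem map_eq_of_prod_X_add_C_eq (f g : Fin m → MvPolynomial (Fin 2) ℂ)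
    (h : (∏ j, (Polynomial.X + Polynomial.C (f j))) = ∏ j, (Polynomial.X + Polynomial.C (g j))) :
    (Finset.univ : Finset (Fin m)).val.map f = (Finset.univ : Finset (Fin m)).val.map g := by
  classical
  have key : ∀ w : Fin m → MvPolynomial (Fin 2) ℂ,
      (∏ j, (Polynomial.X + Polynomial.C (w j))).roots = (Finset.univ : Finset (Fin m)).val.map (fun j => - w j) := by
    intro w
    have h1 : (∏ j, (Polynomial.X + Polynomial.C (w j))) =
        (((Finset.univ : Finset (Fin m)).val.map (fun j => - w j)).map (fun a => Polynomial.X - Polynomial.C a)).prod := by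
      rw [Multiset.map_map, Finset.prod_eq_multiset_prod]
      congr 1
      refine Multiset.map_congr rfl fun j _ => ?_
      simp [sub_eq_add_neg]
    rw [h1, Polynomial.roots_multiset_prod_X_sub_C]
  have h2 : (Finset.univ : Finset (Fin m)).val.map (fun j => - f j) = (Finset.univ : Finset (Fin m)).val.map (fun j => - g j) := by
    rw [← key f, ← key g, h]
  have h3 := congrArg (Multiset.map (fun a : MvPolynomial (Fin 2) ℂ => -a)) h2
  simp only [Multiset.map_map, Function.comp_def, neg_neg] at h3
  exact h3

/-! ## Fibre sums of the restricted families -/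

section Pairing

variable (u v : Fin m → MvPolynomial (Fin 2) ℂ) (E H : Finset Expo)

/-- The tuples over `H₀ ∪ {0}`, `H₀ = H ∖ {0}`. [folklore] -/
abbrev tupH (m : ℕ) (H : Finset Expo) : Finset (Fin m → Expo) :=
  Fintype.piFinset fun _ : Fin m => insert (0 : Expo) (H.erase 0)

end Pairing

/-- A tuple of letters with point `0` is the zero tuple. [folklore] -/
theorem eq_zero_of_sum_eq_zero (a : Fin m → Expo) (h : ∑ j, a j = 0) : a = 0 := by
  funext j
  exact (Finset.sum_eq_zero_iff.1 h) j (Finset.mem_univ j)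

/-- The tuple weight of the zero tuple is `1`. [folklore] -/
theorem prod_hatCoeff_zero (w : Fin m → MvPolynomial (Fin 2) ℂ) : ∏ j, hatCoeff (w j) ((0 : Fin m → Expo) j) = 1 := by
  refine Finset.prod_eq_one fun j _ => ?_
  simp [hatCoeff]

/-- **Step 1–2: the graded fibre sums of the restricted families agree at every point.**  Under purity and cancellation of all non-zero
`H`-tuple points, for every `r` and `p`:
`Σ_{b ∈ tupH, #supp b = r, Σ b = p} ∏ ŵ^H_u = Σ_{…} ∏ ŵ^H_v`. [folklore] -/
theorem gradedFibreSum_eq (u v : Fin m → MvPolynomial (Fin 2) ℂ) (E H : Finset Expo)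
    (hu0 : ∀ j, coeff 0 (u j) = 0) (hv0 : ∀ j, coeff 0 (v j) = 0) (huE : ∀ j, (u j).support ⊆ E)
    (hvE : ∀ j, (v j).support ⊆ E) (hHE : H ⊆ E)
    (hpure : ∀ a ∈ tuples (fun _ : Fin m => E), ∀ b ∈ tuples (fun _ : Fin m => E), (∀ j, a j = 0 ∨ a j ∈ H) →
        (∑ j, a j) = ∑ j, b j → ∃ σ : Equiv.Perm (Fin m), ∀ j, b j = a (σ j))
    (hcancel : ∀ a ∈ tupH m H, a ≠ 0 → coeff (∑ j, a j) (tailDiff u v) = 0) (r : ℕ) (p : Expo) :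
    ∑ b ∈ ((tupH m H).filter (fun b => (Finset.univ.filter fun j => b j ≠ 0).card = r)).filter (fun b => ∑ j, b j = p),
        ∏ j, hatCoeff (keepSet u (H.erase 0) j) (b j) =
      ∑ b ∈ ((tupH m H).filter (fun b => (Finset.univ.filter fun j => b j ≠ 0).card = r)).filter (fun b => ∑ j, b j = p),
        ∏ j, hatCoeff (keepSet v (H.erase 0) j) (b j) := by
  classical
  set H₀ := H.erase 0 with hH₀
  set A := E.erase 0 with hA
  have hA0 : (0 : Expo) ∉ A := Finset.notMem_erase 0 E
  have hH₀A : H₀ ⊆ A := Finset.erase_subset_erase 0 hHE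
  have huA : ∀ j, (u j).support ⊆ A := fun j x hx =>
    Finset.mem_erase.2 ⟨fun h => (mem_support_iff.1 hx) (h ▸ hu0 j), huE j hx⟩
  have hvA : ∀ j, (v j).support ⊆ A := fun j x hx =>
    Finset.mem_erase.2 ⟨fun h => (mem_support_iff.1 hx) (h ▸ hv0 j), hvE j hx⟩
  -- membership transfers
  have htupE : ∀ a ∈ tupH m H, a ∈ tuples (fun _ : Fin m => E) := by
    intro a ha
    unfold tuples
    refine Fintype.mem_piFinset.2 fun j => ?_
    have := Fintype.mem_piFinset.1 ha j
    rcases Finset.mem_insert.1 this with h | h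
    · rw [h]; exact Finset.mem_insert_self _ _
    · exact Finset.mem_insert_of_mem (hHE (Finset.mem_of_mem_erase h))
  have htupH : ∀ a ∈ tupH m H, ∀ j, a j = 0 ∨ a j ∈ H := by
    intro a ha j
    rcases Finset.mem_insert.1 (Fintype.mem_piFinset.1 ha j) with h | h
    · exact Or.inl h
    · exact Or.inr (Finset.mem_of_mem_erase h)
  have hTupAE : ∀ b ∈ Fintype.piFinset (fun _ : Fin m => insert (0 : Expo) A), b ∈ tuples (fun _ : Fin m => E) := by
    intro b hb
    unfold tuples
    refine Fintype.mem_piFinset.2 fun j => ?_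
    rcases Finset.mem_insert.1 (Fintype.mem_piFinset.1 hb j) with h | h
    · rw [h]; exact Finset.mem_insert_self _ _
    · exact Finset.mem_insert_of_mem (Finset.mem_of_mem_erase h)
  -- rearrangements of an `H`-tuple are `H`-tuples with the same number of non-zero slots
  have hrearr : ∀ a ∈ tupH m H, ∀ b : Fin m → Expo, ∀ σ : Equiv.Perm (Fin m), (∀ j, b j = a (σ j)) →
      b ∈ tupH m H ∧ (Finset.univ.filter fun j => b j ≠ 0).card = (Finset.univ.filter fun j => a j ≠ 0).card := by
    intro a ha b σ hσ
    refine ⟨Fintype.mem_piFinset.2 fun j => ?_, card_support_comp_perm a b σ hσ⟩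
    rw [hσ j]
    exact Fintype.mem_piFinset.1 ha (σ j)
  -- the two index sets `S_r,p` coincide; name it
  set S := ((tupH m H).filter (fun b => (Finset.univ.filter fun j => b j ≠ 0).card = r)).filter (fun b => ∑ j, b j = p)
    with hS
  by_cases hex : ∃ a ∈ tupH m H, a ≠ 0 ∧ ∑ j, a j = p
  · obtain ⟨a, ha, ha0, hap⟩ := hex
    -- the fibre of `p` in the big tuple set is the fibre in `tupH`
    have hfib : ∀ w : Fin m → MvPolynomial (Fin 2) ℂ, (∀ j, (w j).support ⊆ A) →
        coeff p (∏ j, (1 + w j)) = ∑ b ∈ (tupH m H).filter (fun b => ∑ j, b j = p), ∏ j, hatCoeff (w j) (b j) := by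
      intro w hw
      rw [coeff_prod_one_add_eq_fibreSum w (fun _ => A) (fun _ => hA0) hw p]
      refine Finset.sum_congr ?_ fun _ _ => rfl
      ext b
      simp only [Finset.mem_filter]
      constructor
      · rintro ⟨hb, hbp⟩
        obtain ⟨σ, hσ⟩ := hpure a (htupE a ha) b (hTupAE b hb) (htupH a ha) (hap.trans hbp.symm)
        exact ⟨(hrearr a ha b σ hσ).1, hbp⟩
      · rintro ⟨hb, hbp⟩
        refine ⟨Fintype.mem_piFinset.2 fun j => ?_, hbp⟩
        rcases Finset.mem_insert.1 (Fintype.mem_piFinset.1 hb j) with h | h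
        · rw [h]; exact Finset.mem_insert_self _ _
        · exact Finset.mem_insert_of_mem (hH₀A h)
    -- cancellation at `p` ⇒ equality of the (ungraded) fibre sums of the restricted families
    have hc : coeff p (tailDiff u v) = 0 := hap ▸ hcancel a ha ha0
    have hsuppK : ∀ w : Fin m → MvPolynomial (Fin 2) ℂ, ∀ j, (keepSet w H₀ j).support ⊆ A := fun w j x hx =>
      hH₀A (Finset.mem_inter.1 (support_keepSet_subset w H₀ j hx)).2
    have hung : ∑ b ∈ (tupH m H).filter (fun b => ∑ j, b j = p), ∏ j, hatCoeff (keepSet u H₀ j) (b j) =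
        ∑ b ∈ (tupH m H).filter (fun b => ∑ j, b j = p), ∏ j, hatCoeff (keepSet v H₀ j) (b j) := by
      have e1 : ∑ b ∈ (tupH m H).filter (fun b => ∑ j, b j = p), ∏ j, hatCoeff (keepSet u H₀ j) (b j) =
          ∑ b ∈ (tupH m H).filter (fun b => ∑ j, b j = p), ∏ j, hatCoeff (u j) (b j) :=
        Finset.sum_congr rfl fun b hb => prod_hatCoeff_keepSet u H₀ (Finset.mem_filter.1 hb).1
      have e2 : ∑ b ∈ (tupH m H).filter (fun b => ∑ j, b j = p), ∏ j, hatCoeff (keepSet v H₀ j) (b j) =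
          ∑ b ∈ (tupH m H).filter (fun b => ∑ j, b j = p), ∏ j, hatCoeff (v j) (b j) :=
        Finset.sum_congr rfl fun b hb => prod_hatCoeff_keepSet v H₀ (Finset.mem_filter.1 hb).1
      rw [e1, e2, ← hfib u huA, ← hfib v hvA]
      have : tailDiff u v = ∏ j, (1 + u j) - ∏ j, (1 + v j) := rfl
      rw [this, coeff_sub] at hc
      exact sub_eq_zero.1 hc
    -- the graded index set: all of the fibre if `r` matches, empty otherwise
    have hSeq : S = if (Finset.univ.filter fun j => a j ≠ 0).card = r then (tupH m H).filter (fun b => ∑ j, b j = p) else ∅ := by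
      ext b
      simp only [hS, Finset.mem_filter]
      split_ifs with hr
      · simp only [Finset.mem_filter]
        constructor
        · rintro ⟨⟨hb, -⟩, hbp⟩; exact ⟨hb, hbp⟩
        · rintro ⟨hb, hbp⟩
          obtain ⟨σ, hσ⟩ := hpure a (htupE a ha) b (htupE b hb) (htupH a ha) (hap.trans hbp.symm)
          exact ⟨⟨hb, (hrearr a ha b σ hσ).2.trans hr⟩, hbp⟩
      · simp only [Finset.notMem_empty, iff_false, not_and]
        intro hb hbp
        obtain ⟨σ, hσ⟩ := hpure a (htupE a ha) b (htupE b hb.1) (htupH a ha) (hap.trans hbp.symm)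
        exact hr ((hrearr a ha b σ hσ).2 ▸ hb.2)
    rw [hSeq]
    split_ifs
    · exact hung
    · simp
  · -- no non-zero `H`-tuple has point `p`: the index set contains at most the zero tuple, where both weights are `1`
    push Not at hex
    refine Finset.sum_congr rfl fun b hb => ?_
    have hb1 := Finset.mem_filter.1 hb
    have hb2 := Finset.mem_filter.1 hb1.1
    have hb0 : b = 0 := by
      by_contra hne
      exact hex b hb2.1 hne hb1.2
    subst hb0
    rw [prod_hatCoeff_zero, prod_hatCoeff_zero]

/-- **Step 2: the elementary symmetric polynomials of the restricted tails agree.** [folklore] -/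
theorem esymm_keepSet_eq (u v : Fin m → MvPolynomial (Fin 2) ℂ) (E H : Finset Expo)
    (hu0 : ∀ j, coeff 0 (u j) = 0) (hv0 : ∀ j, coeff 0 (v j) = 0) (huE : ∀ j, (u j).support ⊆ E)
    (hvE : ∀ j, (v j).support ⊆ E) (hHE : H ⊆ E)
    (hpure : ∀ a ∈ tuples (fun _ : Fin m => E), ∀ b ∈ tuples (fun _ : Fin m => E), (∀ j, a j = 0 ∨ a j ∈ H) →
        (∑ j, a j) = ∑ j, b j → ∃ σ : Equiv.Perm (Fin m), ∀ j, b j = a (σ j))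
    (hcancel : ∀ a ∈ tupH m H, a ≠ 0 → coeff (∑ j, a j) (tailDiff u v) = 0) (r : ℕ) :
    ∑ J ∈ (Finset.univ : Finset (Fin m)).powersetCard r, ∏ j ∈ J, keepSet u (H.erase 0) j =
      ∑ J ∈ (Finset.univ : Finset (Fin m)).powersetCard r, ∏ j ∈ J, keepSet v (H.erase 0) j := by
  classical
  have h0 : (0 : Expo) ∉ H.erase 0 := Finset.notMem_erase 0 H
  have hsu : ∀ j, (keepSet u (H.erase 0) j).support ⊆ H.erase 0 := fun j x hx =>
    (Finset.mem_inter.1 (support_keepSet_subset u _ j hx)).2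
  have hsv : ∀ j, (keepSet v (H.erase 0) j).support ⊆ H.erase 0 := fun j x hx =>
    (Finset.mem_inter.1 (support_keepSet_subset v _ j hx)).2
  ext p
  rw [coeff_esymm_eq_fibreSum _ (H.erase 0) h0 hsu r p, coeff_esymm_eq_fibreSum _ (H.erase 0) h0 hsv r p]
  exact gradedFibreSum_eq u v E H hu0 hv0 huE hvE hHE hpure hcancel r p

/-- **Step 3: Vieta.** The root polynomials `∏_j (Z + u^H_j)` and `∏_j (Z + v^H_j)` coincide. [folklore] -/
theorem prod_X_add_C_keepSet_eq (u v : Fin m → MvPolynomial (Fin 2) ℂ) (E H : Finset Expo)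
    (hu0 : ∀ j, coeff 0 (u j) = 0) (hv0 : ∀ j, coeff 0 (v j) = 0) (huE : ∀ j, (u j).support ⊆ E)
    (hvE : ∀ j, (v j).support ⊆ E) (hHE : H ⊆ E)
    (hpure : ∀ a ∈ tuples (fun _ : Fin m => E), ∀ b ∈ tuples (fun _ : Fin m => E), (∀ j, a j = 0 ∨ a j ∈ H) →
        (∑ j, a j) = ∑ j, b j → ∃ σ : Equiv.Perm (Fin m), ∀ j, b j = a (σ j))
    (hcancel : ∀ a ∈ tupH m H, a ≠ 0 → coeff (∑ j, a j) (tailDiff u v) = 0) :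
    (∏ j, (Polynomial.X + Polynomial.C (keepSet u (H.erase 0) j))) =
      ∏ j, (Polynomial.X + Polynomial.C (keepSet v (H.erase 0) j)) := by
  classical
  apply Polynomial.ext
  intro k
  by_cases hk : k ≤ m
  · rw [Finset.prod_X_add_C_coeff _ _ (by simpa using hk), Finset.prod_X_add_C_coeff _ _ (by simpa using hk)]
    exact esymm_keepSet_eq u v E H hu0 hv0 huE hvE hHE hpure hcancel _
  · push Not at hk
    have hdeg : ∀ w : Fin m → MvPolynomial (Fin 2) ℂ, (∏ j, (Polynomial.X + Polynomial.C (w j))).natDegree ≤ m :=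
      fun w => (Polynomial.natDegree_prod_le _ _).trans (by simp)
    rw [Polynomial.coeff_eq_zero_of_natDegree_lt ((hdeg _).trans_lt hk),
      Polynomial.coeff_eq_zero_of_natDegree_lt ((hdeg _).trans_lt hk)]

/-- **K4 L4 — NEWTON–VIETA PAIRING OF THE HIGH LETTERS** (`HighLetterPairing`, val-idea-36 g0's text verbatim in `…SubmergedDefs`).
[folklore] -/
theorem highLetterPairing_holds : HighLetterPairing := by
  intro m u v E H hu0 hv0 huE hvE hHE hpure ξ l hξ htop habove
  classical
  -- cancellation of every non-zero `H`-tuple point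
  have hcancel : ∀ a ∈ tupH m H, a ≠ 0 → coeff (∑ j, a j) (tailDiff u v) = 0 := by
    intro a ha ha0
    have haH : a ∈ tuples (fun _ : Fin m => H) := by
      unfold tuples
      refine Fintype.mem_piFinset.2 fun j => ?_
      rcases Finset.mem_insert.1 (Fintype.mem_piFinset.1 ha j) with h | h
      · rw [h]; exact Finset.mem_insert_self _ _
      · exact Finset.mem_insert_of_mem (Finset.mem_of_mem_erase h)
    have hlt := habove a haH ha0
    by_contra hne
    have hmem : (∑ j, a j) ∈ ((tailDiff u v).support : Set Expo) := Finset.mem_coe.2 (mem_support_iff.2 hne)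
    have hne' : (∑ j, a j) ≠ l := fun h => by rw [h] at hlt; exact lt_irrefl _ hlt
    have := htop.2 _ hmem hne'
    linarith
  -- Steps 1–3 and the root multisets
  have hQ := prod_X_add_C_keepSet_eq u v E H hu0 hv0 huE hvE hHE hpure hcancel
  have hms := map_eq_of_prod_X_add_C_eq _ _ hQ
  -- Step 4: the permutation
  obtain ⟨σ, hσ⟩ := exists_perm_of_map_eq _ _ hms
  refine ⟨σ, fun j e he => ?_⟩
  by_cases he0 : e = 0
  · rw [he0, hu0, hv0]
  · have heH : e ∈ H.erase 0 := Finset.mem_erase.2 ⟨he0, he⟩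
    have h1 := congrArg (coeff e) (hσ j)
    rw [coeff_keepSet, coeff_keepSet, if_pos heH, if_pos heH] at h1
    exact h1

/-- **K4 L5 — THE DEPTH COROLLARY** (`SubmergedDepthBound`, val-idea-36 g0's text verbatim in `…SubmergedDefs`): with pure fibres on the
whole alphabet, some non-zero letter tuple has its point at or below the visible point (else L4 with `H = E` pairs ALL rows,
`∏(1+u) = ∏(1+v)`, and there is no visible point at all). [folklore] -/
theorem submergedDepthBound_holds : SubmergedDepthBound := by
  intro m u v E hu0 hv0 huE hvE hpure ξ l hξ htop
  classical
  by_contra hcon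
  push Not at hcon
  obtain ⟨σ, hσ⟩ := highLetterPairing_holds m u v E E hu0 hv0 huE hvE subset_rfl
    (fun a ha b hb _ hab => hpure a ha b hb hab) ξ l hξ htop (fun a ha ha0 => hcon a ha ha0)
  have hvu : ∀ j, v (σ j) = u j := by
    intro j
    ext e
    by_cases he : e ∈ E
    · exact hσ j e he
    · rw [notMem_support_iff.1 (fun h => he (hvE _ h)), notMem_support_iff.1 (fun h => he (huE _ h))]
  have hprod : ∏ j, (1 + v j) = ∏ j, (1 + u j) := by
    rw [← Equiv.prod_comp σ (fun j => 1 + v j)]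
    exact Finset.prod_congr rfl fun j _ => by rw [hvu j]
  have h0 : tailDiff u v = 0 := by
    unfold tailDiff
    rw [hprod, sub_self]
  have h1 := htop.1
  rw [h0, support_zero] at h1
  simp at h1

end Summit.ValiantsHypothesis.ValiantsHypothesis.Theorems.NewtonUnitEquations.TwoProducts.Submerged

end
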